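import Summits.BirchSwinnertonDyer.BirchSwinnertonDyer.Theorems.PublishedInputsGreenbergLayerFormalPrimary
import HarnessLib

set_option linter.dupNamespace false -- `…BirchSwinnertonDyer.BirchSwinnertonDyer…` is the cell's nested layout (D-0017)
set_option autoImplicit false

/-!
# Greenberg LNM 1716 Lemma 3.4, STRUCTURE of `ker(r_{v_n})`: the two factors are CYCLIC —
# `(Ê(𝔪̄)^{H_∞}/(g^{pⁿ}−1))[p^∞]` (≅ `ker(a_{v_n}) ≅ Ẽ(f_{v_n})_p`) and the `p`-part of any finite group of reductions

Seat `bsd-inputs-k4-p1` (gen 6; LADDER-BSD D-0154 KEY (147)(f) «prove the printed input», row 1 K4 INPUTS; Greenberg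
1999), `--supports stmt-BirchSwinnertonDyer-20309`. THEOREMS ONLY (no definition, no named fact, no `sorry`).

Toward the named fact `Greenberg1999.lemma34_localTowerKerPrimary_cyclicExtension_rat` (LNM 1716 §3, proof of Lemma 3.4,
p. 89, with Prop. 2.5, p. 80: `ker(r_{v_n})` has a CYCLIC subgroup `ker(a_{v_n}) ≅ Ẽ(f_{v_n})_p` with CYCLIC quotient
`≅ ker(d_{v_n})`, "a quotient of the cyclic `Ẽ(𝔽_p)_p ⊂ Ẽ[p^∞] ≅ ℚ_p/ℤ_p`", p. 73). Cyclicity is read off COUNTS: a finite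
abelian `p`-group `G` with `#G[p^k] ≤ p^k` for every `k` is cyclic (Mathlib's `isAddCyclic_of_card_nsmul_eq_zero_le`).

* `isAddCyclic_of_forall_natCard_torsionBy_le` — the criterion for additive `p`-groups.
* `isAddCyclic_primaryComponent_coinv_formal_layer` — `(M₁/(g^{pⁿ}−1)M₁)[p^∞]` is cyclic, from the depth-`p^k` counts
  `#(M₁/D₁M₁)[p^k] = #(Ê[p^k])^τ ≤ #Ê[p^k] = p^k` (brick 7, `natCard_torsionBy_coinv_formal_eq_layer`).
* `isAddCyclic_primaryComponent_addSubgroup_reduction` — for the abstract reduction `red₀` with the ordinary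
  filtration (`hgenr`, `hsurj`: `#B[p^k] = p^k`, as in gen 5's `…Lemma34FixedCount`), the `p`-primary part of every FINITE
  subgroup of `B` is cyclic.
* `exists_addSubgroup_cyclic_of_addEquiv` — transport of a cyclic-by-cyclic structure along an additive equivalence.

HONEST FRAMING: TOOL theorems; close nothing; no summit statement is proved; BSD is not proved by any of this.

References: [GreenbergLNM1716] §2 pp. 73, 80 (Prop. 2.5), §3 Lemma 3.4 (p. 89); [SilvermanAEC2009] III.6.4.
-/

noncomputable section

open scoped Classical NNReal AddSubgroup

namespace Summit.BirchSwinnertonDyer.BirchSwinnertonDyer.Theorems.InputsGreenbergLemma34Layer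

open CategoryTheory NumberField IsDedekindDomain Field
  Literature.NumberTheory.GaloisRepresentations Literature.NumberTheory.GaloisRepresentations.DiscreteGaloisModule
  IsDedekindDomain.HeightOneSpectrum Literature.NumberTheory.EllipticCurves.FormalGroupChart
  _root_.TopRep _root_.ContRepresentation _root_.ContinuousCohomology WeierstrassCurve
  Summit.BirchSwinnertonDyer.BirchSwinnertonDyer.Theorems.GoodOrdTower
  Summit.BirchSwinnertonDyer.BirchSwinnertonDyer.Theorems.InputsGreenbergLemma34
open Literature.NumberTheory.EllipticCurves hiding subgroupIncl

/-! ## §1 The counting criterion for cyclicity of a finite `p`-group -/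

/-- In an additive group, an element killed by `m` prime to `p` and by a power of `p` is `0`. [folklore] -/
theorem eq_zero_of_nsmul_eq_zero_of_coprime {A : Type*} [AddCommGroup A] (p : ℕ) [hp : Fact p.Prime]
    {m : ℕ} (hm : ¬ p ∣ m) (a : A) (hma : m • a = 0) (hpa : ∃ e : ℕ, p ^ e • a = 0) : a = 0 := by
  obtain ⟨e, he⟩ := hpa
  have hcop : Nat.Coprime m (p ^ e) := (Nat.Coprime.pow_right _ ((Nat.Prime.coprime_iff_not_dvd hp.out).mpr hm).symm)
  have hord : addOrderOf a ∣ Nat.gcd m (p ^ e) :=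
    Nat.dvd_gcd (addOrderOf_dvd_of_nsmul_eq_zero hma) (addOrderOf_dvd_of_nsmul_eq_zero he)
  rw [hcop, Nat.dvd_one, AddMonoid.addOrderOf_eq_one_iff] at hord
  exact hord

/-- **A finite additive `p`-group `G` with `#G[p^k] ≤ p^k` for every `k` is cyclic.** For `n = p^k m`, `p ∤ m`,
`{a : n a = 0} = G[p^k]` (an element of a `p`-group killed by `m` and a power of `p` vanishes), so `#{a : n a = 0} ≤ p^k ≤ n`
and Mathlib's `isAddCyclic_of_card_nsmul_eq_zero_le` applies. [cite: SilvermanAEC2009, III.6.4] -/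
theorem isAddCyclic_of_forall_natCard_torsionBy_le {G : Type*} [AddCommGroup G] [Finite G] (p : ℕ) [hp : Fact p.Prime]
    (hG : ∀ g : G, ∃ e : ℕ, p ^ e • g = 0) (hk : ∀ k : ℕ, Nat.card {g : G // p ^ k • g = 0} ≤ p ^ k) :
    IsAddCyclic G := by
  letI : Fintype G := Fintype.ofFinite G
  refine isAddCyclic_of_card_nsmul_eq_zero_le fun n hn ↦ ?_
  obtain ⟨k, m, hm, rfl⟩ := Nat.exists_eq_pow_mul_and_not_dvd hn.ne' p hp.out.ne_one
  have hm0 : 0 < m := Nat.pos_of_ne_zero fun h ↦ by rw [h, mul_zero] at hn; exact lt_irrefl 0 hn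
  have hset : ∀ g : G, (p ^ k * m) • g = 0 ↔ p ^ k • g = 0 := by
    intro g
    constructor
    · intro h
      rw [mul_comm, mul_smul] at h
      obtain ⟨e, he⟩ := hG (p ^ k • g)
      exact eq_zero_of_nsmul_eq_zero_of_coprime p hm _ h ⟨e, he⟩
    · intro h
      rw [mul_comm, mul_smul, h, smul_zero]
  have hcard : (Finset.univ.filter fun g : G ↦ (p ^ k * m) • g = 0).card = Nat.card {g : G // p ^ k • g = 0} := by
    rw [Nat.card_eq_fintype_card, Fintype.card_subtype]
    congr 1
    exact Finset.filter_congr fun g _ ↦ hset g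
  rw [hcard]
  exact (hk k).trans (Nat.le_mul_of_pos_right _ hm0)

/-- **Transport of a cyclic-by-cyclic structure along an additive equivalence** `e : K ≃+ P`: if `A ≤ P` is cyclic of
order `N` and `P ⧸ A` embeds into a cyclic group, then `K` has a cyclic subgroup of order `N` with cyclic quotient.
[folklore] -/
theorem exists_addSubgroup_cyclic_of_addEquiv {K P C : Type*} [AddCommGroup K] [AddCommGroup P] [AddCommGroup C]
    (e : K ≃+ P) (A : AddSubgroup P) (hA : IsAddCyclic A) [IsAddCyclic C] (f : P ⧸ A →+ C)
    (hf : Function.Injective f) (N : ℕ) (hN : Nat.card A = N) :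
    ∃ A' : AddSubgroup K, IsAddCyclic A' ∧ IsAddCyclic (K ⧸ A') ∧ Nat.card A' = N := by
  let A' : AddSubgroup K := A.comap e.toAddMonoidHom
  have hmap : A'.map (e : K →+ P) = A := by
    ext x
    constructor
    · rintro ⟨y, hy, rfl⟩
      exact hy
    · intro hx
      exact ⟨e.symm x, by change e (e.symm x) ∈ A; rw [e.apply_symm_apply]; exact hx, e.apply_symm_apply x⟩
  -- `A' ≃+ A`
  let eA : A' ≃+ A :=
    { toFun := fun a ↦ ⟨e a.1, a.2⟩
      invFun := fun a ↦ ⟨e.symm a.1, by change e (e.symm a.1) ∈ A; rw [e.apply_symm_apply]; exact a.2⟩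
      left_inv := fun a ↦ Subtype.ext (e.symm_apply_apply a.1)
      right_inv := fun a ↦ Subtype.ext (e.apply_symm_apply a.1)
      map_add' := fun a b ↦ Subtype.ext (by simp) }
  refine ⟨A', ?_, ?_, ?_⟩
  · exact isAddCyclic_of_surjective eA.symm eA.symm.surjective
  · -- `K/A' ≃+ P/A ↪ C`
    let eQ : K ⧸ A' ≃+ P ⧸ A := QuotientAddGroup.congr A' A e hmap
    let g : K ⧸ A' →+ C := f.comp eQ.toAddMonoidHom
    have hg : Function.Injective g := hf.comp eQ.injective
    haveI : IsAddCyclic g.range := AddSubgroup.isAddCyclic _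
    exact isAddCyclic_of_surjective (AddMonoidHom.ofInjective hg).symm (AddMonoidHom.ofInjective hg).symm.surjective
  · rw [← hN]; exact Nat.card_congr eA.toEquiv

/-! ## §2 The `p`-part of a finite group of reductions is cyclic -/

universe u v

/-- **The `p`-primary part of a finite group of reduction values is cyclic.** For a field `E` of characteristic `0` over
`K`, an elliptic `W/K` and an abstract reduction `red₀ : E(K̄_E) → B` with the ordinary filtration (`hgenr`: `ker red₀ ∩ E[p^r]`
cyclic of order `p^r`; `hsurj`: `red₀(E[p^r]) = B[p^r]`), `#B[p^r] = p^r` for every `r` (gen 5, `…Lemma34FixedCount`), so the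
`p`-primary part of every finite subgroup `S ≤ B` satisfies the counting criterion. ("`Ẽ(𝔽_p)_p ⊂ Ẽ[p^∞] ≅ ℚ_p/ℤ_p` is
cyclic", Greenberg p. 73.) [cite: GreenbergLNM1716, §2 p. 73] [cite: SilvermanAEC2009, III.6.4] -/
theorem isAddCyclic_primaryComponent_addSubgroup_reduction {K : Type u} [Field K] (W : WeierstrassCurve K)
    [W.IsElliptic] (E : Type u) [Field E] [Algebra K E] [CharZero E] {p : ℕ} [hp : Fact p.Prime]
    {B : Type v} [AddCommGroup B] (red₀ : localPoints W E →+ B)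
    (hgenr : ∀ r : ℕ, ∃ P₁ : localPoints W E, red₀ P₁ = 0 ∧ addOrderOf P₁ = p ^ r ∧
      ∀ P : localPoints W E, red₀ P = 0 → ((p ^ r : ℕ) : ℤ) • P = 0 → ∃ c : ℕ, P = c • P₁)
    (hsurj : ∀ (r : ℕ) (y : B), ((p ^ r : ℕ) : ℤ) • y = 0 →
      ∃ x : localPoints W E, ((p ^ r : ℕ) : ℤ) • x = 0 ∧ red₀ x = y)
    (S : AddSubgroup B) [Finite S] : IsAddCyclic (AddCommGroup.primaryComponent S p) := by
  -- adapted from Summits/.../Theorems/PublishedInputsGreenbergLemma34FixedCount.lean (gen 5: `#B[p^r] = p^r`)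
  let P : Type u := localPoints W E
  have hpr : ∀ r : ℕ, p ^ r ≠ 0 := fun r ↦ pow_ne_zero r hp.out.ne_zero
  let Cr : ℕ → AddSubgroup P := fun r ↦ red₀.ker ⊓ AddSubgroup.torsionBy P ((p ^ r : ℕ) : ℤ)
  have hmemC : ∀ (r : ℕ) (Q : P), Q ∈ Cr r ↔ red₀ Q = 0 ∧ ((p ^ r : ℕ) : ℤ) • Q = 0 := fun r Q ↦ by
    change Q ∈ red₀.ker ⊓ AddSubgroup.torsionBy P ((p ^ r : ℕ) : ℤ) ↔ _
    rw [AddSubgroup.mem_inf, AddMonoidHom.mem_ker, mem_torsionBy_iff]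
  have hcardC : ∀ r : ℕ, Nat.card (Cr r) = p ^ r := by
    intro r
    obtain ⟨P₁, hP₁, hord₁, hgen₁⟩ := hgenr r
    have hP₁C : P₁ ∈ Cr r := (hmemC r P₁).mpr ⟨hP₁, by rw [natCast_zsmul, ← hord₁, addOrderOf_nsmul_eq_zero]⟩
    have hCeq : Cr r = AddSubgroup.zmultiples P₁ := by
      refine le_antisymm ?_ (AddSubgroup.zmultiples_le.mpr hP₁C)
      intro Q hQ
      obtain ⟨c, rfl⟩ := hgen₁ Q ((hmemC r Q).mp hQ).1 ((hmemC r Q).mp hQ).2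
      exact AddSubgroup.mem_zmultiples_iff.mpr ⟨c, natCast_zsmul P₁ c⟩
    rw [hCeq, Nat.card_zmultiples, hord₁]
  have hBcard : ∀ r : ℕ, Nat.card (B[(p ^ r : ℕ)]) = p ^ r := by
    intro r
    have hsurj' : ∀ y ∈ B[(p ^ r : ℕ)], ∃ x ∈ (localPoints W E)[(p ^ r : ℕ)], red₀ x = y := by
      intro y hy
      obtain ⟨x, hx, hxy⟩ := hsurj r y (mem_torsionBy_iff.mp hy)
      exact ⟨x, mem_torsionBy_iff.mpr hx, hxy⟩
    have hmul := TateModule.card_ker_torsionBy_mul_card red₀ (p ^ r) hsurj'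
    have hA : Nat.card ((localPoints W E)[(p ^ r : ℕ)]) = p ^ r * p ^ r := by
      haveI : PerfectField E := PerfectField.ofCharZero
      have h := card_torsionBy_eq_sq (E := W.baseChange (AlgebraicClosure E)) (n := p ^ r)
        (by exact_mod_cast hpr r)
      rw [sq] at h
      exact h
    have hker : Nat.card ((red₀.ker)[(p ^ r : ℕ)]) = p ^ r := by
      refine Eq.trans (Nat.card_congr (⟨fun x ↦ ⟨((x : red₀.ker) : P),
        (hmemC r _).mpr ⟨(x : red₀.ker).2, ?_⟩⟩, fun y ↦ ⟨⟨(y : P), ((hmemC r _).mp y.2).1⟩, ?_⟩,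
        fun x ↦ rfl, fun y ↦ rfl⟩ : (red₀.ker)[(p ^ r : ℕ)] ≃ Cr r)) (hcardC r)
      · exact congrArg Subtype.val (mem_torsionBy_iff.mp x.2)
      · rw [mem_torsionBy_iff]
        apply Subtype.ext
        exact ((hmemC r _).mp y.2).2
    rw [hker, hA] at hmul
    exact Nat.eq_of_mul_eq_mul_left (Nat.pos_of_ne_zero (hpr r)) hmul
  -- the criterion for `S[p^∞]`
  haveI : Finite (B[(p ^ 0 : ℕ)]) := Nat.finite_of_card_ne_zero (by rw [hBcard]; exact hpr 0)
  refine isAddCyclic_of_forall_natCard_torsionBy_le p (fun g ↦ ?_) fun k ↦ ?_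
  · obtain ⟨e, he⟩ := (AddCommGroup.mem_primaryComponent).mp g.2
    exact ⟨e, Subtype.ext (by rw [AddSubmonoidClass.coe_nsmul, he, ZeroMemClass.coe_zero])⟩
  · haveI : Finite (B[(p ^ k : ℕ)]) := Nat.finite_of_card_ne_zero (by rw [hBcard]; exact hpr k)
    have hmem : ∀ g : {g : AddCommGroup.primaryComponent S p // p ^ k • g = 0},
        (((g.1 : AddCommGroup.primaryComponent S p) : S) : B) ∈ B[(p ^ k : ℕ)] := fun g ↦ by
      rw [mem_torsionBy_iff, natCast_zsmul]
      have h := congrArg (fun z : AddCommGroup.primaryComponent S p ↦ ((z : S) : B)) g.2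
      simpa only [AddSubmonoidClass.coe_nsmul, ZeroMemClass.coe_zero] using h
    let ι : {g : AddCommGroup.primaryComponent S p // p ^ k • g = 0} → B[(p ^ k : ℕ)] := fun g ↦ ⟨_, hmem g⟩
    have hιval : ∀ g, ((ι g : B[(p ^ k : ℕ)]) : B) = (((g.1 : AddCommGroup.primaryComponent S p) : S) : B) :=
      fun _ ↦ rfl
    have hι : Function.Injective ι := by
      intro a b h
      have h' : (((a.1 : AddCommGroup.primaryComponent S p) : S) : B) = (((b.1 : AddCommGroup.primaryComponent S p) : S) : B) := by
        rw [← hιval a, ← hιval b, h]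
      exact Subtype.ext (Subtype.ext (Subtype.ext h'))
    exact (Nat.card_le_card_of_injective ι hι).trans (le_of_eq (hBcard k))

/-! ## §3 `(M₁/(g^{pⁿ}−1)M₁)[p^∞]` is cyclic -/

variable {p : ℕ} [hp : Fact p.Prime] {κ : ZpExtension ℚ p} in
set_option maxHeartbeats 1600000 in
/-- **`(Ê(𝔪̄)^{H_∞}/(g^{pⁿ} − 1))[p^∞]` is CYCLIC** (the factor `ker(a_{v_n}) ≅ Ẽ(f_{v_n})_p` of Greenberg's Lemma 3.4 at the
layer `n` over `ℚ`), in the setting of `natCard_primaryComponent_coinv_formal_eq_layer`: it is finite (brick 8) and its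
`p^k`-torsion has `#(Ê[p^k])^τ ≤ #Ê[p^k] = p^k` elements (brick 7), so the counting criterion applies.
[cite: GreenbergLNM1716, §2 Prop. 2.5 (p. 80), §3 Lemma 3.4 (p. 89)] -/
theorem isAddCyclic_primaryComponent_coinv_formal_layer (hκ : κ.IsCyclotomic) (v : HeightOneSpectrum (𝓞 ℚ))
    (hv : ((p : ℕ) : 𝓞 ℚ) ∈ v.asIdeal)
    (W : WeierstrassCurve ℚ) [W.IsElliptic] (n : ℕ)
    {w : Valuation (AlgebraicClosure (v.adicCompletion ℚ)) ℝ≥0}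
    (hw : ∀ x, (w x : ℝ) = spectralNorm (v.adicCompletion ℚ) (AlgebraicClosure (v.adicCompletion ℚ)) x)
    [hV : (W.baseChange (AlgebraicClosure (v.adicCompletion ℚ))).IsIntegral w.integer]
    [(W.baseChange (AlgebraicClosure (v.adicCompletion ℚ))).IsElliptic]
    [hVL : (W.baseChange (IntermediateField.fixedField
        (localSubgroup (κ.layerSubgroup n) (v.adicCompletion ℚ)) :
          IntermediateField (v.adicCompletion ℚ) (AlgebraicClosure (v.adicCompletion ℚ)))).IsIntegral
      (w.comap (algebraMap (IntermediateField.fixedField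
        (localSubgroup (κ.layerSubgroup n) (v.adicCompletion ℚ)) :
          IntermediateField (v.adicCompletion ℚ) (AlgebraicClosure (v.adicCompletion ℚ)))
        (AlgebraicClosure (v.adicCompletion ℚ)))).integer]
    {B : Type} [AddCommGroup B] (red₀ : localPoints W (v.adicCompletion ℚ) →+ B)
    (hker : ∀ Q : localPoints W (v.adicCompletion ℚ), red₀ Q = 0 ↔
      (Q : (W.baseChange (AlgebraicClosure (v.adicCompletion ℚ))).toAffine.Point) ∈
        kernel w (W.baseChange (AlgebraicClosure (v.adicCompletion ℚ))))
    (hstab : ∀ (σ : absoluteGaloisGroup (v.adicCompletion ℚ)) (Q : localPoints W (v.adicCompletion ℚ)),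
      red₀ Q = 0 → red₀ (σ • Q) = 0)
    (hdiv₁ : ∀ a : localPoints W (v.adicCompletion ℚ), red₀ a = 0 →
      ∃ b : localPoints W (v.adicCompletion ℚ), red₀ b = 0 ∧ p • b = a)
    (hgenr : ∀ r : ℕ, ∃ P₁ : localPoints W (v.adicCompletion ℚ), red₀ P₁ = 0 ∧ addOrderOf P₁ = p ^ r ∧
      ∀ P : localPoints W (v.adicCompletion ℚ), red₀ P = 0 → ((p ^ r : ℕ) : ℤ) • P = 0 → ∃ c : ℕ, P = c • P₁)
    (hsurj : ∀ (r : ℕ) (y : B), ((p ^ r : ℕ) : ℤ) • y = 0 →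
      ∃ x : localPoints W (v.adicCompletion ℚ), ((p ^ r : ℕ) : ℤ) • x = 0 ∧ red₀ x = y)
    {τ : absoluteGaloisGroup (v.adicCompletion ℚ)}
    (hτHi : τ ∈ localSubgroup κ.kerSubgroup (v.adicCompletion ℚ))
    (hτfix : ∀ (r : ℕ) (ξ : AlgebraicClosure (v.adicCompletion ℚ)), ξ ^ p ^ r = 1 → τ • ξ = ξ)
    (hHensel : ∀ Q : localPoints W (v.adicCompletion ℚ), red₀ (τ • Q) = red₀ Q →
      ∃ P₀ : localPoints W (v.adicCompletion ℚ),
        (∀ σ : absoluteGaloisGroup (v.adicCompletion ℚ), σ • P₀ = P₀) ∧ red₀ P₀ = red₀ Q)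
    (hns : Function.Surjective (κ.toContinuousMonoidHom.comp (resGal (K := ℚ) (v.adicCompletion ℚ))))
    {g : absoluteGaloisGroup (v.adicCompletion ℚ)}
    (hγ : (κ.localize (closureEmb (K := ℚ) (v.adicCompletion ℚ)) hns).IsTopGenerator g)
    (M₁ : AddSubgroup (localPoints W (v.adicCompletion ℚ)))
    (hM₁ : ∀ a, a ∈ M₁ ↔ a ∈ red₀.ker ∧ ∀ h ∈ localSubgroup κ.kerSubgroup (v.adicCompletion ℚ), h • a = a)
    (D₁ : M₁ →+ M₁) (hD₁ : ∀ a : M₁, ((D₁ a : M₁) : localPoints W (v.adicCompletion ℚ)) = (g ^ p ^ n) • (a : _) - a)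
    (hCG : ∀ ψ : contOneCocycles (discreteTopRep (localSubgroup κ.kerSubgroup (v.adicCompletion ℚ))
        (localPoints W (v.adicCompletion ℚ))),
      (∀ τ', red₀ (ψ.1 τ') = 0) →
        ∃ e : localPoints W (v.adicCompletion ℚ), red₀ e = 0 ∧
          ∀ τ' : localSubgroup κ.kerSubgroup (v.adicCompletion ℚ),
            ψ.1 τ' = (τ' : absoluteGaloisGroup (v.adicCompletion ℚ)) • e - e)
    (SF : Finset B) (hSF : ∀ Q : localPoints W (v.adicCompletion ℚ), red₀ (τ • Q) = red₀ Q → red₀ Q ∈ SF) :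
    IsAddCyclic (AddCommGroup.primaryComponent (M₁ ⧸ D₁.range) p) := by
  let K := v.adicCompletion ℚ
  let P : Type := localPoints W K
  let X₁ := M₁ ⧸ D₁.range
  have hpr : ∀ r : ℕ, p ^ r ≠ 0 := fun r ↦ pow_ne_zero r hp.out.ne_zero
  -- finiteness (brick 8)
  obtain ⟨hfin, -⟩ := natCard_primaryComponent_coinv_formal_eq_layer hκ v hv W n hw red₀ hker hstab hdiv₁ hgenr hsurj
    hτHi hτfix hHensel hns hγ M₁ hM₁ D₁ hD₁ hCG SF hSF
  haveI := hfin
  refine isAddCyclic_of_forall_natCard_torsionBy_le p (fun g ↦ ?_) fun k ↦ ?_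
  · obtain ⟨e, he⟩ := (AddCommGroup.mem_primaryComponent).mp g.2
    exact ⟨e, Subtype.ext (by rw [AddSubmonoidClass.coe_nsmul, he, ZeroMemClass.coe_zero])⟩
  · -- depth `p^k`: `#X₁[p^k] = #(C_k)^τ ≤ #C_k = p^k` (brick 7)
    let C : AddSubgroup P := red₀.ker ⊓ AddSubgroup.torsionBy P ((p ^ k : ℕ) : ℤ)
    have hC : ∀ a : P, a ∈ C ↔ red₀ a = 0 ∧ p ^ k • a = 0 := fun a ↦ by
      change a ∈ red₀.ker ⊓ AddSubgroup.torsionBy P ((p ^ k : ℕ) : ℤ) ↔ _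
      rw [AddSubgroup.mem_inf, AddMonoidHom.mem_ker]
      exact and_congr Iff.rfl AddSubgroup.torsionBy.nsmul_iff
    obtain ⟨hfink, hcount⟩ := natCard_torsionBy_coinv_formal_eq_layer hκ v hv W n k hw red₀ hker hstab hdiv₁ hgenr hsurj
      hτHi hτfix hHensel hns hγ M₁ hM₁ D₁ hD₁ hCG C hC
    -- `#C = p^k`
    obtain ⟨Pk, hPk0, hPkord, hPkgen⟩ := hgenr k
    have hPkC : Pk ∈ C := (hC Pk).mpr ⟨hPk0, by rw [← hPkord]; exact addOrderOf_nsmul_eq_zero Pk⟩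
    have hCeq : C = AddSubgroup.zmultiples Pk := by
      refine le_antisymm ?_ (AddSubgroup.zmultiples_le.mpr hPkC)
      intro Q hQ
      obtain ⟨c, rfl⟩ := hPkgen Q ((hC Q).mp hQ).1 (by rw [natCast_zsmul]; exact ((hC Q).mp hQ).2)
      exact AddSubgroup.mem_zmultiples_iff.mpr ⟨c, natCast_zsmul Pk c⟩
    have hCcard : Nat.card C = p ^ k := by rw [hCeq, Nat.card_zmultiples, hPkord]
    haveI : Finite C := Nat.finite_of_card_ne_zero (by rw [hCcard]; exact hpr k)
    -- `{g ∈ X₁[p^∞] : p^k g = 0} ≃ X₁[p^k]`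
    have hcard1 : Nat.card {g : AddCommGroup.primaryComponent X₁ p // p ^ k • g = 0} =
        Nat.card {c : X₁ // p ^ k • c = 0} := by
      refine Nat.card_congr ?_
      exact
        { toFun := fun g ↦ ⟨(g.1 : X₁), by
            have h := congrArg (fun z : AddCommGroup.primaryComponent X₁ p ↦ (z : X₁)) g.2
            simpa only [AddSubmonoidClass.coe_nsmul, ZeroMemClass.coe_zero] using h⟩
          invFun := fun c ↦ ⟨⟨c.1, (AddCommGroup.mem_primaryComponent).mpr ⟨k, c.2⟩⟩, Subtype.ext (by
            rw [AddSubmonoidClass.coe_nsmul, ZeroMemClass.coe_zero]; exact c.2)⟩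
          left_inv := fun g ↦ Subtype.ext (Subtype.ext rfl)
          right_inv := fun c ↦ Subtype.ext rfl }
    rw [hcard1, hcount, ← hCcard]
    exact Nat.card_le_card_of_injective (fun c : {c : C // τ • (c : P) = c} ↦ (c.1 : C))
      fun a b h ↦ Subtype.ext h

end Summit.BirchSwinnertonDyer.BirchSwinnertonDyer.Theorems.InputsGreenbergLemma34Layer

end
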